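import Mathlib.Algebra.Group.End
import Mathlib.CategoryTheory.SingleObj
import Mathlib.Data.PNat.Basic
import Mathlib.Tactic.Ring
import Literature.AlgebraicGeometry.Frobenioids.CategoriesFactorizationSingleObj
import HarnessLib

/-!
# Frobenioids I, §0: an FSMFF one-object base that is NOT a groupoid — the affine monoid `Aff⁺(ℤ) = ℤ ⋊ ℕ_{≥1}`

S. Mochizuki, *The geometry of Frobenioids I: the general theory*, Kyushu J. Math. **62** (2008), §0, kurims p. 14
(fiberwise-surjective morphisms, FSM-morphisms, categories of FSM-type), pp. 17–18 (categories of FSMFF-type: "if `C` is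
of FSM-type, then it is of FSMFF-type") [cite: MochizukiFrdI2008, §0 p.14]; the semi-direct product bases `U ⋊ N` of
Examples 3.8 / 3.9, p. 71–72 [cite: MochizukiFrdI2008, Ex. 3.9 p.72].

abc-iut cell, block F, seat abc-iut-f-133 (gen 2).  A DATA brick (definitions = the monoid and its coordinates; no
instances, no notation) for the closure-side census of the [EtTh] Cor. 3.8 rows F-2809 / F-2812 / F-2815
(`TemperedFrobenioidCor38Sub.lean`): every one-object base `SingleObj M` used so far by the cell's typed tempered
Frobenioids was either a GROUPOID (`PUnit`, `SingleObj G`) — making "`Base(φ)` is an isomorphism" automatic — or NOT of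
FSMFF-type (`SingleObj ℕ_{≥1}` of the dilation swap, abc-iut-f-142).  By `isOfFSMFFType_iff_isOfFSMType_of_subsingleton`
(p449550) a one-object base is admissible for `Cor38Hyp.fsmff` iff every FSM endomorphism is invertible.  THIS file
provides such a base WITH non-invertible arrows: the monoid `Aff⁺(ℤ)` of affine self-maps `x ↦ n·x + u` of `ℤ`
(`n ∈ ℕ_{≥1}`, `u ∈ ℤ`), realised as a submonoid of Mathlib's `Function.End ℤ` (law
`(n₁,u₁)·(n₂,u₂) = (n₁n₂, u₁ + n₁u₂)`), with coordinates `expo`, `trans`.  PROVED: `SingleObj Aff⁺(ℤ)` is connected and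
totally epimorphic; an arrow with `expo ≥ 2` is NOT fiberwise-surjective (`(n,u)` and `(n,u+1)` have no common right
multiple: `n ∣ 1`), so every FSM arrow has `expo = 1` and is invertible — the category is of FSM-type, hence of
FSMFF-type — while `x ↦ 2x` is a non-invertible arrow.  Intended use (this seat's STATUS 15:02Z): the base of an
ADMISSIBLE degree↔dilation swap.  HONEST FRAMING: [FrdI] §0 bookkeeping about a toy base; nothing here bears on
[IUTchIII] Cor. 3.12; no side taken.
-/

namespace Literature.AlgebraicGeometry.Frobenioids

open CategoryTheory

namespace IntAffine

/-! ## §1 The affine maps `x ↦ n·x + u` of `ℤ` as elements of `End(ℤ)` -/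

/-- The affine self-map `x ↦ n·x + u` of `ℤ` (`n ∈ ℕ_{≥1}`, `u ∈ ℤ`). [cite: MochizukiFrdI2008, Ex. 3.9 p.72] -/
def affMap (n : ℕ+) (u : ℤ) : Function.End ℤ := fun x => ((n : ℕ) : ℤ) * x + u

/-- Values of `affMap`. [cite: MochizukiFrdI2008, Ex. 3.9 p.72] -/
@[simp] theorem affMap_apply (n : ℕ+) (u x : ℤ) : affMap n u x = ((n : ℕ) : ℤ) * x + u := rfl

/-- The identity is `x ↦ 1·x + 0`. [cite: MochizukiFrdI2008, Ex. 3.9 p.72] -/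
theorem affMap_one_zero : affMap 1 0 = 1 := by
  funext x
  show ((((1 : ℕ+) : ℕ) : ℤ)) * x + 0 = x
  rw [PNat.one_coe, Nat.cast_one, one_mul, add_zero]

/-- Composition law: `(n₁,u₁) ∘ (n₂,u₂) = (n₁n₂, u₁ + n₁u₂)` (the `U ⋊ N` law of [FrdI] Ex. 3.8/3.9 with `N` acting on
`U = ℤ` by multiplication). [cite: MochizukiFrdI2008, Ex. 3.9 p.72] -/
theorem affMap_mul (n₁ n₂ : ℕ+) (u₁ u₂ : ℤ) :
    affMap n₁ u₁ * affMap n₂ u₂ = affMap (n₁ * n₂) (u₁ + ((n₁ : ℕ) : ℤ) * u₂) := by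
  funext x
  show ((n₁ : ℕ) : ℤ) * (((n₂ : ℕ) : ℤ) * x + u₂) + u₁ = (((n₁ * n₂ : ℕ+) : ℕ) : ℤ) * x + (u₁ + ((n₁ : ℕ) : ℤ) * u₂)
  rw [PNat.mul_coe, Nat.cast_mul]
  ring

/-- `affMap` is injective in `(n, u)` (evaluate at `0` and `1`). [cite: MochizukiFrdI2008, Ex. 3.9 p.72] -/
theorem affMap_injective {n n' : ℕ+} {u u' : ℤ} (h : affMap n u = affMap n' u') : n = n' ∧ u = u' := by
  have h0 := congrFun h 0
  have h1 := congrFun h 1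
  simp only [affMap_apply, mul_zero, zero_add, mul_one] at h0 h1
  refine ⟨PNat.coe_inj.mp (by exact_mod_cast (show ((n : ℕ) : ℤ) = (n' : ℕ) by omega)), h0⟩

/-- **`Aff⁺(ℤ) ⊆ End(ℤ)`**, the submonoid of affine maps `x ↦ n·x + u`, `n ≥ 1`. [cite: MochizukiFrdI2008, Ex. 3.9 p.72] -/
def affSub : Submonoid (Function.End ℤ) where
  carrier := {f | ∃ (n : ℕ+) (u : ℤ), f = affMap n u}
  one_mem' := ⟨1, 0, affMap_one_zero.symm⟩
  mul_mem' := by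
    rintro f g ⟨n₁, u₁, rfl⟩ ⟨n₂, u₂, rfl⟩
    exact ⟨n₁ * n₂, u₁ + ((n₁ : ℕ) : ℤ) * u₂, affMap_mul n₁ n₂ u₁ u₂⟩

/-- The monoid `Aff⁺(ℤ)` (as a type: the submonoid `affSub`, with Mathlib's induced monoid structure).
[cite: MochizukiFrdI2008, Ex. 3.9 p.72] -/
abbrev G : Type := ↥affSub

/-- The element `(n, u)` of `Aff⁺(ℤ)`. [cite: MochizukiFrdI2008, Ex. 3.9 p.72] -/
def mk (n : ℕ+) (u : ℤ) : G := ⟨affMap n u, n, u, rfl⟩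

/-- Multiplication of the elements `(n, u)`. [cite: MochizukiFrdI2008, Ex. 3.9 p.72] -/
theorem mk_mul_mk (n₁ n₂ : ℕ+) (u₁ u₂ : ℤ) : mk n₁ u₁ * mk n₂ u₂ = mk (n₁ * n₂) (u₁ + ((n₁ : ℕ) : ℤ) * u₂) :=
  Subtype.ext (affMap_mul n₁ n₂ u₁ u₂)

/-- `(1, 0)` is the unit. [cite: MochizukiFrdI2008, Ex. 3.9 p.72] -/
theorem mk_one_zero : mk 1 0 = 1 := Subtype.ext affMap_one_zero

/-- `mk` is injective. [cite: MochizukiFrdI2008, Ex. 3.9 p.72] -/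
theorem mk_injective {n n' : ℕ+} {u u' : ℤ} (h : mk n u = mk n' u') : n = n' ∧ u = u' :=
  affMap_injective (congrArg Subtype.val h)

/-- The scaling exponent `n` of an element of `Aff⁺(ℤ)`. [cite: MochizukiFrdI2008, Ex. 3.9 p.72] -/
noncomputable def expo (g : G) : ℕ+ := Classical.choose g.2

/-- The translation part `u` of an element of `Aff⁺(ℤ)`. [cite: MochizukiFrdI2008, Ex. 3.9 p.72] -/
noncomputable def trans (g : G) : ℤ := Classical.choose (Classical.choose_spec g.2)

/-- Every element is `(expo g, trans g)`. [cite: MochizukiFrdI2008, Ex. 3.9 p.72] -/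
theorem eq_mk (g : G) : g = mk (expo g) (trans g) :=
  Subtype.ext (Classical.choose_spec (Classical.choose_spec g.2))

/-- Coordinates of `mk n u`. [cite: MochizukiFrdI2008, Ex. 3.9 p.72] -/
theorem expo_mk (n : ℕ+) (u : ℤ) : expo (mk n u) = n := (mk_injective (eq_mk (mk n u))).1.symm

/-- Coordinates of `mk n u`. [cite: MochizukiFrdI2008, Ex. 3.9 p.72] -/
theorem trans_mk (n : ℕ+) (u : ℤ) : trans (mk n u) = u := (mk_injective (eq_mk (mk n u))).2.symm

/-- `expo` is multiplicative. [cite: MochizukiFrdI2008, Ex. 3.9 p.72] -/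
theorem expo_mul (g h : G) : expo (g * h) = expo g * expo h := by
  conv_lhs => rw [eq_mk g, eq_mk h, mk_mul_mk, expo_mk]

/-- `trans (g·h) = trans g + expo g · trans h`. [cite: MochizukiFrdI2008, Ex. 3.9 p.72] -/
theorem trans_mul (g h : G) : trans (g * h) = trans g + ((expo g : ℕ) : ℤ) * trans h := by
  conv_lhs => rw [eq_mk g, eq_mk h, mk_mul_mk, trans_mk]

/-- `expo 1 = 1`. [cite: MochizukiFrdI2008, Ex. 3.9 p.72] -/
theorem expo_one : expo (1 : G) = 1 := by rw [← mk_one_zero, expo_mk]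

/-- `trans 1 = 0`. [cite: MochizukiFrdI2008, Ex. 3.9 p.72] -/
theorem trans_one : trans (1 : G) = 0 := by rw [← mk_one_zero, trans_mk]

/-- `Aff⁺(ℤ)` is right-cancellative: `f·g = h·g ⇒ f = h`. [cite: MochizukiFrdI2008, §0 p.15] -/
theorem mul_right_cancel' {f g h : G} (e : f * g = h * g) : f = h := by
  have hn : expo f = expo h := by
    have := congrArg expo e
    rw [expo_mul, expo_mul] at this
    exact mul_right_cancel this
  have hu : trans f = trans h := by
    have := congrArg trans e
    rw [trans_mul, trans_mul, hn] at this
    omega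
  rw [eq_mk f, eq_mk h, hn, hu]

/-- The units of `Aff⁺(ℤ)` are exactly the translations (`expo = 1`). [cite: MochizukiFrdI2008, Ex. 3.9 p.72] -/
theorem isUnit_iff_expo_eq_one (g : G) : IsUnit g ↔ expo g = 1 := by
  constructor
  · rintro ⟨w, rfl⟩
    have h := congrArg expo w.mul_inv
    rw [expo_mul, expo_one] at h
    have h' : ((expo (w : G) : ℕ+) : ℕ) * ((expo (↑w⁻¹ : G) : ℕ+) : ℕ) = 1 := by
      rw [← PNat.mul_coe, h, PNat.one_coe]
    exact PNat.coe_inj.mp (by rw [PNat.one_coe]; exact Nat.eq_one_of_mul_eq_one_right h')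
  · intro h
    obtain ⟨u, hu⟩ : ∃ u, g = mk 1 u := ⟨trans g, by rw [← h]; exact eq_mk g⟩
    subst hu
    refine ⟨⟨mk 1 u, mk 1 (-u), ?_, ?_⟩, rfl⟩
    · rw [mk_mul_mk, mul_one, PNat.one_coe, Nat.cast_one, one_mul, add_neg_cancel, mk_one_zero]
    · rw [mk_mul_mk, mul_one, PNat.one_coe, Nat.cast_one, one_mul, neg_add_cancel, mk_one_zero]

/-- `x ↦ 2x` is not invertible in `Aff⁺(ℤ)`. [cite: MochizukiFrdI2008, Ex. 3.9 p.72] -/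
theorem not_isUnit_mk_two : ¬ IsUnit (mk 2 0) := by
  rw [isUnit_iff_expo_eq_one, expo_mk]
  decide

/-! ## §2 The one-object base `D = SingleObj Aff⁺(ℤ)`: connected, totally epimorphic, of FSM-type, hence FSMFF -/

/-- The base category. [cite: MochizukiFrdI2008, §0 p.14] -/
abbrev D : Type := SingleObj G

/-- `D` is connected. [cite: MochizukiFrdI2008, §0 p.15] -/
theorem isConnected_D : IsConnected D := zigzag_isConnected fun _ _ => Relation.ReflTransGen.refl

/-- `D` is totally epimorphic (`Aff⁺(ℤ)` is right-cancellative; in `SingleObj`, `δ ≫ β = β * δ`).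
[cite: MochizukiFrdI2008, §0 p.15] -/
theorem isTotallyEpimorphic_D : IsTotallyEpimorphic D :=
  ⟨fun β => ⟨fun f h e => by
    rw [SingleObj.comp_as_mul, SingleObj.comp_as_mul] at e
    exact mul_right_cancel' e⟩⟩

/-- **An arrow with `expo ≥ 2` is NOT fiberwise-surjective**: `β = (n,u)` and `γ = (n,u+1)` admit no common right
multiple (`u + n·a = u + 1 + n·a'` forces `n ∣ 1`). [cite: MochizukiFrdI2008, §0 p.14] -/
theorem not_isFiberwiseSurjective_of_expo_ne_one {A B : D} (β : A ⟶ B) (hβ : expo β ≠ 1) :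
    ¬ IsFiberwiseSurjective β := by
  intro h
  obtain ⟨X, δB, δX, e⟩ := h (show A ⟶ B from mk (expo β) (trans β + 1))
  rw [SingleObj.comp_as_mul, SingleObj.comp_as_mul] at e
  have ht := congrArg trans e
  rw [trans_mul, trans_mul, trans_mk, expo_mk] at ht
  -- `trans β + n·a = trans β + 1 + n·a'`
  have hdvd : ((expo β : ℕ) : ℤ) ∣ 1 :=
    ⟨trans (show G from δB) - trans (show G from δX), by linarith [ht]⟩
  have h1 : ((expo β : ℕ) : ℤ) = 1 :=
    Int.eq_one_of_dvd_one (by exact_mod_cast (expo β).pos.le) hdvd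
  exact hβ (PNat.coe_inj.mp (by exact_mod_cast h1))

/-- In `SingleObj Aff⁺(ℤ)` an arrow is an isomorphism iff it is a unit of the monoid. [folklore] -/
private theorem isIso_iff_isUnit {A B : D} (f : A ⟶ B) : IsIso f ↔ IsUnit (show G from f) := by
  constructor
  · intro hf
    refine ⟨⟨f, inv f, ?_, ?_⟩, rfl⟩
    · have h := IsIso.inv_hom_id f
      change (show G from f) * (show G from inv f) = (1 : G) at h
      exact h
    · have h := IsIso.hom_inv_id f
      change (show G from inv f) * (show G from f) = (1 : G) at h
      exact h
  · rintro ⟨w, hw⟩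
    refine ⟨⟨(show B ⟶ A from (↑w⁻¹ : G)), ?_, ?_⟩⟩
    · change (↑w⁻¹ : G) * (show G from f) = (1 : G)
      rw [← hw]
      exact w.inv_mul
    · change (show G from f) * (↑w⁻¹ : G) = (1 : G)
      rw [← hw]
      exact w.mul_inv

/-- **`D` is of FSM-type**: an FSM arrow is fiberwise-surjective, hence has `expo = 1`, hence is a translation, which is
invertible. [cite: MochizukiFrdI2008, §0 p.14] -/
theorem isOfFSMType_D : IsOfFSMType D :=
  ⟨fun f hf => by
    have h1 : expo f = 1 := by
      by_contra h
      exact not_isFiberwiseSurjective_of_expo_ne_one f h hf.1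
    exact (isIso_iff_isUnit f).mpr ((isUnit_iff_expo_eq_one _).mpr h1)⟩

/-- **`D` is of FSMFF-type** ("if `C` is of FSM-type, then it is of FSMFF-type", §0 p. 18) — so it is an admissible base
for the REAL clause `Cor38Hyp.fsmff` of [EtTh] Cor. 3.8. [cite: MochizukiFrdI2008, §0 p.18] -/
theorem isOfFSMFFType_D : IsOfFSMFFType D := isOfFSMType_D.isOfFSMFFType

/-- **`D` is NOT a groupoid**: the dilation `x ↦ 2x` is a non-invertible arrow (so "`Base(φ)` is an isomorphism" is a
genuine condition over this base). [cite: MochizukiFrdI2008, §0 p.14] -/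
theorem not_isIso_dilation : ¬ IsIso (show SingleObj.star G ⟶ SingleObj.star G from mk 2 0) := fun h =>
  not_isUnit_mk_two ((isIso_iff_isUnit _).mp h)

end IntAffine

end Literature.AlgebraicGeometry.Frobenioids
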